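import Mathlib.MeasureTheory.Integral.Bochner.Set
import Mathlib.MeasureTheory.Measure.Real
import Mathlib.Algebra.QuadraticDiscriminant
import HarnessLib

/-!
# The second-moment method for a finite family of events

For finitely many events `A_i` (`i ∈ S`) of a finite measure space,

  `(Σ_i μ(A_i))² ≤ μ(⋃_i A_i) · Σ_{i,j} μ(A_i ∩ A_j)`

(`sq_sum_measureReal_le_measureReal_biUnion_mul_sum`), i.e. `μ(⋃_i A_i) ≥ E[X]² / E[X²]` for the
counting variable `X = Σ_i 1_{A_i}` (`sq_sum_measureReal_div_le_measureReal_biUnion`, the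
inequality of Chung–Erdős), and its WEIGHTED form
`(Σ_i w_i μ(A_i))² ≤ μ(⋃_i A_i) · Σ_{i,j} w_i w_j μ(A_i ∩ A_j)` for arbitrary real weights `w`
(`sq_sum_mul_measureReal_le_measureReal_biUnion_mul_sum`, `X = Σ_i w_i 1_{A_i}` — Lyons–Peres'
weighted count `X(μ)`, Prop. 5.11 as printed; the weights are what make the bound a CAPACITY
lower bound `P[o ↔ Π] ≥ 1/inf_μ ℰ(μ)`, ibid. (5.10) and Prop. 5.12). This is the Cauchy–Schwarz step
`E[X]² = E[X 1_{[X>0]}]² ≤ E[X²] P[X > 0]` of Lyons–Peres 2016, Prop. 5.11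
(`P[o ↔ Π] ≥ 1/E[X(μ)²]`), equivalently the case `t = 0` of the Paley–Zygmund inequality
(ibid. §5.5). The proof integrates the square `(t·1_U − X)² ≥ 0` (`U = ⋃ A_i`, `X = X·1_U`) and
reads off the sign of the discriminant of the resulting quadratic in `t` (`discrim_le_zero`);
`E[X] = Σ μ(A_i)`, `E[X²] = Σ_{i,j} μ(A_i ∩ A_j)`, `E[1_U] = μ(U)`.

Mathlib has Chebyshev (`ProbabilityTheory.meas_ge_le_variance_div_sq`) but neither Paley–Zygmund
nor this union bound (searched: `Paley`, `second moment`, `Chung`).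

## References

* R. Lyons, Y. Peres, *Probability on Trees and Networks*, CUP 2016, §5.3, Prop. 5.11 (p. 231),
  §5.5 (Paley–Zygmund). [LyonsPeres2016]
-/

namespace Literature.Probability.Percolation

open _root_.MeasureTheory

/-- **Second-moment (Cauchy–Schwarz) bound for a finite union of events** (Lyons–Peres 2016,
Prop. 5.11, the step `E[X]² ≤ E[X²] P[X > 0]` for `X = Σ_i 1_{A_i}`): for finitely many
measurable events `A_i`, `i ∈ S`, of a finite measure `μ`,
`(Σ_{i ∈ S} μ(A_i))² ≤ μ(⋃_{i ∈ S} A_i) · Σ_{i ∈ S} Σ_{j ∈ S} μ(A_i ∩ A_j)`.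
[cite: LyonsPeres2016, §5.3 Prop. 5.11] -/
theorem sq_sum_measureReal_le_measureReal_biUnion_mul_sum {Ω ι : Type*} [MeasurableSpace Ω]
    (μ : Measure Ω) [IsFiniteMeasure μ] (S : Finset ι) (A : ι → Set Ω)
    (hA : ∀ i ∈ S, MeasurableSet (A i)) :
    (∑ i ∈ S, μ.real (A i)) ^ 2 ≤
      μ.real (⋃ i ∈ S, A i) * ∑ i ∈ S, ∑ j ∈ S, μ.real (A i ∩ A j) := by
  classical
  set U : Set Ω := ⋃ i ∈ S, A i with hU_def
  have hU : MeasurableSet U := Finset.measurableSet_biUnion S hA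
  -- the counting variable `f = Σ 1_{A_i}`, its square `g`, and `u = 1_U`
  set f : Ω → ℝ := fun ω => ∑ i ∈ S, (A i).indicator 1 ω with hf_def
  set g : Ω → ℝ := fun ω => ∑ i ∈ S, ∑ j ∈ S, (A i ∩ A j).indicator 1 ω with hg_def
  set u : Ω → ℝ := U.indicator 1 with hu_def
  -- indicators of measurable sets are integrable (stated with `Set.indicator s 1` verbatim)
  have hind : ∀ s : Set Ω, MeasurableSet s → Integrable (s.indicator (1 : Ω → ℝ)) μ :=
    fun s hs => (integrable_const (1 : ℝ)).indicator hs
  have hf_int : Integrable f μ := integrable_finsetSum _ fun i hi => hind _ (hA i hi)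
  have hg_int : Integrable g μ :=
    integrable_finsetSum _ fun i hi => integrable_finsetSum _ fun j hj =>
      hind _ ((hA i hi).inter (hA j hj))
  have hu_int : Integrable u μ := hind _ hU
  -- their integrals
  have hint_f : ∫ ω, f ω ∂μ = ∑ i ∈ S, μ.real (A i) := by
    simp only [hf_def]
    rw [integral_finsetSum _ (fun i hi => hind _ (hA i hi))]
    exact Finset.sum_congr rfl fun i hi => integral_indicator_one (hA i hi)
  have hint_g : ∫ ω, g ω ∂μ = ∑ i ∈ S, ∑ j ∈ S, μ.real (A i ∩ A j) := by
    simp only [hg_def]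
    rw [integral_finsetSum _ (fun i hi => integrable_finsetSum _ fun j hj =>
      hind _ ((hA i hi).inter (hA j hj)))]
    refine Finset.sum_congr rfl fun i hi => ?_
    rw [integral_finsetSum _ (fun j hj => hind _ ((hA i hi).inter (hA j hj)))]
    exact Finset.sum_congr rfl fun j hj => integral_indicator_one ((hA i hi).inter (hA j hj))
  have hint_u : ∫ ω, u ω ∂μ = μ.real U := integral_indicator_one hU
  -- pointwise: `(t u - f)² = t² u - 2 t f + g` (`u² = u`, `u f = f`, `f² = g`)
  have hg' : ∀ ω, g ω = f ω * f ω := by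
    intro ω
    simp only [hf_def, hg_def, Finset.sum_mul_sum]
    refine Finset.sum_congr rfl fun i _ => Finset.sum_congr rfl fun j _ => ?_
    rw [Set.inter_indicator_one, Pi.mul_apply]
  have hpt : ∀ t : ℝ, ∀ ω, (t * u ω - f ω) ^ 2 = t * t * u ω - 2 * t * f ω + g ω := by
    intro t ω
    by_cases hω : ω ∈ U
    · have hu1 : u ω = 1 := by simp [hu_def, hω]
      rw [hu1, hg']
      ring
    · have hu0 : u ω = 0 := by simp [hu_def, hω]
      have hf0 : f ω = 0 := by
        simp only [hf_def]
        refine Finset.sum_eq_zero fun i hi => ?_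
        exact Set.indicator_of_notMem (fun h => hω (Set.mem_iUnion₂.2 ⟨i, hi, h⟩)) _
      rw [hu0, hg', hf0]
      ring
  -- the quadratic `t ↦ ∫ (t u - f)² ≥ 0`
  have hquad : ∀ t : ℝ, 0 ≤ μ.real U * (t * t) + (-2 * ∑ i ∈ S, μ.real (A i)) * t +
      ∑ i ∈ S, ∑ j ∈ S, μ.real (A i ∩ A j) := by
    intro t
    have h1 : Integrable (fun ω => t * t * u ω - 2 * t * f ω) μ :=
      (hu_int.const_mul _).sub (hf_int.const_mul _)
    have hint : ∫ ω, (t * u ω - f ω) ^ 2 ∂μ = μ.real U * (t * t) +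
        (-2 * ∑ i ∈ S, μ.real (A i)) * t + ∑ i ∈ S, ∑ j ∈ S, μ.real (A i ∩ A j) := by
      simp_rw [hpt t]
      rw [integral_add h1 hg_int, integral_sub (hu_int.const_mul _) (hf_int.const_mul _),
        integral_const_mul, integral_const_mul, hint_u, hint_f, hint_g]
      ring
    rw [← hint]
    exact integral_nonneg fun ω => sq_nonneg _
  have hdisc := discrim_le_zero hquad
  rw [discrim] at hdisc
  nlinarith [hdisc]

/-- **The Chung–Erdős form**: `μ(⋃_{i ∈ S} A_i) ≥ (Σ_i μ(A_i))² / Σ_{i,j} μ(A_i ∩ A_j)`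
(when the denominator vanishes the left side is `0`). This is `P[X > 0] ≥ E[X]²/E[X²]` for
`X = Σ 1_{A_i}` (Lyons–Peres 2016, Prop. 5.11; §5.5, Paley–Zygmund at `0`).
[cite: LyonsPeres2016, §5.3 Prop. 5.11] -/
theorem sq_sum_measureReal_div_le_measureReal_biUnion {Ω ι : Type*} [MeasurableSpace Ω]
    (μ : Measure Ω) [IsFiniteMeasure μ] (S : Finset ι) (A : ι → Set Ω)
    (hA : ∀ i ∈ S, MeasurableSet (A i)) :
    (∑ i ∈ S, μ.real (A i)) ^ 2 / (∑ i ∈ S, ∑ j ∈ S, μ.real (A i ∩ A j)) ≤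
      μ.real (⋃ i ∈ S, A i) := by
  have h := sq_sum_measureReal_le_measureReal_biUnion_mul_sum μ S A hA
  rcases (Finset.sum_nonneg fun i _ => Finset.sum_nonneg fun j _ =>
      (measureReal_nonneg : 0 ≤ μ.real (A i ∩ A j))).eq_or_lt with h0 | hpos
  · rw [← h0, div_zero]
    exact measureReal_nonneg
  · rw [div_le_iff₀ hpos]
    exact h

/-- **Weighted second-moment bound for a finite union of events** (Lyons–Peres 2016, Prop. 5.11
as printed, with the weighted count `X(μ) = Σ_e μ(e) 1_{[e ∈ K(o)]}/P[e ∈ K(o)]`; here with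
arbitrary real weights `w_i`, the normalisation being immaterial): for finitely many measurable
events `A_i`, `i ∈ S`, of a finite measure `μ`,
`(Σ_{i ∈ S} w_i μ(A_i))² ≤ μ(⋃_{i ∈ S} A_i) · Σ_{i ∈ S} Σ_{j ∈ S} w_i w_j μ(A_i ∩ A_j)`,
i.e. `E[X]² = E[X 1_U]² ≤ μ(U) E[X²]` for `X = Σ_i w_i 1_{A_i}`, `U = ⋃_i A_i`. Same proof as the
unweighted `sq_sum_measureReal_le_measureReal_biUnion_mul_sum` (the case `w ≡ 1`).
Equivalently `μ(⋃ A_i) ≥ sup_w (Σ w_i μ(A_i))²/Σ w_i w_j μ(A_i ∩ A_j) = 1/inf_μ ℰ(μ)`, the capacity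
lower bound of Lyons–Peres (5.10)/Prop. 5.12. [cite: LyonsPeres2016, §5.3 Prop. 5.11] -/
theorem sq_sum_mul_measureReal_le_measureReal_biUnion_mul_sum {Ω ι : Type*} [MeasurableSpace Ω]
    (μ : Measure Ω) [IsFiniteMeasure μ] (S : Finset ι) (A : ι → Set Ω) (w : ι → ℝ)
    (hA : ∀ i ∈ S, MeasurableSet (A i)) :
    (∑ i ∈ S, w i * μ.real (A i)) ^ 2 ≤
      μ.real (⋃ i ∈ S, A i) * ∑ i ∈ S, ∑ j ∈ S, w i * w j * μ.real (A i ∩ A j) := by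
  classical
  set U : Set Ω := ⋃ i ∈ S, A i with hU_def
  have hU : MeasurableSet U := Finset.measurableSet_biUnion S hA
  -- the weighted counting variable `f = Σ w_i 1_{A_i}`, its square `g`, and `u = 1_U`
  set f : Ω → ℝ := fun ω => ∑ i ∈ S, w i * (A i).indicator 1 ω with hf_def
  set g : Ω → ℝ := fun ω => ∑ i ∈ S, ∑ j ∈ S, w i * w j * (A i ∩ A j).indicator 1 ω with hg_def
  set u : Ω → ℝ := U.indicator 1 with hu_def
  have hind : ∀ s : Set Ω, MeasurableSet s → Integrable (s.indicator (1 : Ω → ℝ)) μ :=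
    fun s hs => (integrable_const (1 : ℝ)).indicator hs
  have hf_int : Integrable f μ :=
    integrable_finsetSum _ fun i hi => (hind _ (hA i hi)).const_mul (w i)
  have hg_int : Integrable g μ :=
    integrable_finsetSum _ fun i hi => integrable_finsetSum _ fun j hj =>
      (hind _ ((hA i hi).inter (hA j hj))).const_mul (w i * w j)
  have hu_int : Integrable u μ := hind _ hU
  -- their integrals
  have hint_f : ∫ ω, f ω ∂μ = ∑ i ∈ S, w i * μ.real (A i) := by
    simp only [hf_def]
    rw [integral_finsetSum _ (fun i hi => (hind _ (hA i hi)).const_mul (w i))]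
    refine Finset.sum_congr rfl fun i hi => ?_
    rw [integral_const_mul, integral_indicator_one (hA i hi)]
  have hint_g : ∫ ω, g ω ∂μ = ∑ i ∈ S, ∑ j ∈ S, w i * w j * μ.real (A i ∩ A j) := by
    simp only [hg_def]
    rw [integral_finsetSum _ (fun i hi => integrable_finsetSum _ fun j hj =>
      (hind _ ((hA i hi).inter (hA j hj))).const_mul (w i * w j))]
    refine Finset.sum_congr rfl fun i hi => ?_
    rw [integral_finsetSum _ (fun j hj => (hind _ ((hA i hi).inter (hA j hj))).const_mul (w i * w j))]
    refine Finset.sum_congr rfl fun j hj => ?_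
    rw [integral_const_mul, integral_indicator_one ((hA i hi).inter (hA j hj))]
  have hint_u : ∫ ω, u ω ∂μ = μ.real U := integral_indicator_one hU
  -- pointwise: `g = f²`, and `(t u - f)² = t² u - 2 t f + g` (`u² = u`, `u f = f`)
  have hg' : ∀ ω, g ω = f ω * f ω := by
    intro ω
    simp only [hf_def, hg_def, Finset.sum_mul_sum]
    refine Finset.sum_congr rfl fun i _ => Finset.sum_congr rfl fun j _ => ?_
    rw [Set.inter_indicator_one, Pi.mul_apply]
    ring
  have hpt : ∀ t : ℝ, ∀ ω, (t * u ω - f ω) ^ 2 = t * t * u ω - 2 * t * f ω + g ω := by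
    intro t ω
    by_cases hω : ω ∈ U
    · have hu1 : u ω = 1 := by simp [hu_def, hω]
      rw [hu1, hg']
      ring
    · have hu0 : u ω = 0 := by simp [hu_def, hω]
      have hf0 : f ω = 0 := by
        simp only [hf_def]
        refine Finset.sum_eq_zero fun i hi => ?_
        rw [Set.indicator_of_notMem (fun h => hω (Set.mem_iUnion₂.2 ⟨i, hi, h⟩)), mul_zero]
      rw [hu0, hg', hf0]
      ring
  -- the quadratic `t ↦ ∫ (t u - f)² ≥ 0`
  have hquad : ∀ t : ℝ, 0 ≤ μ.real U * (t * t) + (-2 * ∑ i ∈ S, w i * μ.real (A i)) * t +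
      ∑ i ∈ S, ∑ j ∈ S, w i * w j * μ.real (A i ∩ A j) := by
    intro t
    have h1 : Integrable (fun ω => t * t * u ω - 2 * t * f ω) μ :=
      (hu_int.const_mul _).sub (hf_int.const_mul _)
    have hint : ∫ ω, (t * u ω - f ω) ^ 2 ∂μ = μ.real U * (t * t) +
        (-2 * ∑ i ∈ S, w i * μ.real (A i)) * t +
        ∑ i ∈ S, ∑ j ∈ S, w i * w j * μ.real (A i ∩ A j) := by
      simp_rw [hpt t]
      rw [integral_add h1 hg_int, integral_sub (hu_int.const_mul _) (hf_int.const_mul _),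
        integral_const_mul, integral_const_mul, hint_u, hint_f, hint_g]
      ring
    rw [← hint]
    exact integral_nonneg fun ω => sq_nonneg _
  have hdisc := discrim_le_zero hquad
  rw [discrim] at hdisc
  nlinarith [hdisc]

/-- **Weighted Chung–Erdős / capacity form**: for every real weighting `w`,
`(Σ_i w_i μ(A_i))² / Σ_{i,j} w_i w_j μ(A_i ∩ A_j) ≤ μ(⋃_{i ∈ S} A_i)` (left side `0` when the
denominator vanishes, by `x / 0 = 0`). Taking the supremum over `w ≥ 0` gives Lyons–Peres'
`P[o ↔ Π] ≥ 1/inf_μ ℰ(μ)` (Prop. 5.11/5.12 with the energy (5.10)). [cite: LyonsPeres2016, §5.3 Prop. 5.11] -/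
theorem sq_sum_mul_measureReal_div_le_measureReal_biUnion {Ω ι : Type*} [MeasurableSpace Ω]
    (μ : Measure Ω) [IsFiniteMeasure μ] (S : Finset ι) (A : ι → Set Ω) (w : ι → ℝ)
    (hA : ∀ i ∈ S, MeasurableSet (A i)) :
    (∑ i ∈ S, w i * μ.real (A i)) ^ 2 / (∑ i ∈ S, ∑ j ∈ S, w i * w j * μ.real (A i ∩ A j)) ≤
      μ.real (⋃ i ∈ S, A i) := by
  have h := sq_sum_mul_measureReal_le_measureReal_biUnion_mul_sum μ S A w hA
  rcases lt_trichotomy (∑ i ∈ S, ∑ j ∈ S, w i * w j * μ.real (A i ∩ A j)) 0 with hneg | h0 | hpos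
  · -- impossible unless the numerator vanishes: the square is ≤ (nonneg) * (neg) ≤ 0
    have hsq : (∑ i ∈ S, w i * μ.real (A i)) ^ 2 ≤ 0 :=
      h.trans (mul_nonpos_of_nonneg_of_nonpos measureReal_nonneg hneg.le)
    have hsq0 : (∑ i ∈ S, w i * μ.real (A i)) ^ 2 = 0 := le_antisymm hsq (sq_nonneg _)
    rw [hsq0, zero_div]
    exact measureReal_nonneg
  · rw [h0, div_zero]
    exact measureReal_nonneg
  · rw [div_le_iff₀ hpos]
    exact h

end Literature.Probability.Percolation
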